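import Literature.AlgebraicGeometry.Frobenioids.ArithmeticFrobenioidThm64iRatStdVariants
import Literature.AlgebraicGeometry.Frobenioids.Cor54SubBiratCompatProofs
import Literature.AlgebraicGeometry.Frobenioids.ModelFrobenioidBirat
import Literature.AlgebraicGeometry.Frobenioids.EquivalencePreStepsFSMType
import Literature.AlgebraicGeometry.Frobenioids.FinSubextCatFSM
import HarnessLib

/-!
# Frobenioids I, Cor. 4.10 / the hypotheses of Cor. 4.11 AT THE REALIFICATIONS `C_{K/F}^rlf` of the arithmetic
# Frobenioids (Thm. 6.4 (ii), input E5 — part A: everything that does not need Cor. 4.11 (ii)/(iii) themselves)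

Mochizuki, *The geometry of Frobenioids I: the general theory*, Kyushu J. Math. **62** (2008) 293–400, kurims text:
Cor. 4.10 p. 90 l. 30 – p. 91 l. 10; Cor. 4.11 p. 91 l. 28 – p. 92 l. 32 (hypotheses: "`Φ_i` perf-factorial divisorial …
`D_i` Div-slim; `C_i → F_{Φ_i}` a Frobenioid of standard type; … if group-like … preserve base-isomorphisms"); Prop. 5.3
p. 103 ("the realification `C^rlf` … the model Frobenioid associated to the divisor monoid `Φ^rlf` … and the rational
function monoid `ℝ · Φ^birat`"); Thm. 6.4 (i) p. 115 l. 20–21 ("`D` is Div-slim [relative to `Φ`, hence also relative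
to `Φ^pf`, `Φ^rlf`]"), (ii) proof p. 115 l. 34 – p. 116 l. 2 ("[cf. … Corollary 4.10; Corollary 4.11, (iii)]")
[cite: MochizukiFrdI2008, Cor. 4.10 p.90] [cite: MochizukiFrdI2008, Thm. 6.4 (ii) p.115].

PROOF-ONLY file (cell abc-iut, layer L1, node `FrdI:Thm6.4(ii)`, sub-DAG row **T64ii/E5** part A; seat abc-iut-L6-t10
gen 4; sequel `ArithmeticRealificationCor411.lean` adds Cor. 4.11 (ii)/(iii)/(iv) at the realifications):
* `PreFrobenioid.isPerfFactorialOn_rlfFunctor` — `Φ^rlf` is perf-factorial on `D` (Def. 2.4 (i));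
* `PreFrobenioid.biratSubgroup_rlfToElem_eq_realSpan` — generic: for THE realification `C^rlf` of any Frobenioid with
  perf-factorial `Φ`, the rational-function subfunctor `(Φ^rlf)^birat(X)` (Prop. 4.4 (iii), seat abc-iut-L1-t5's
  `biratSubfunctor`) IS the real span `ℝ · Φ^birat(X)` — the rational function monoid of the model Frobenioid `C^rlf`
  (Thm. 5.2 (ii) via seat abc-iut-L1-d2's `ModelFrobenioid.biratSubfunctor_eq_ofModelData`);
* `arith_rlf_cor411Setting` — the hypothesis package `Cor411Setting` HOLDS at `(C_{K₁/F₁}^rlf, C_{K₂/F₂}^rlf, Ψ^rlf)` for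
  EVERY equivalence `Ψ^rlf` (Div-slim rel. `Φ^rlf`: this lineage's `arithFrobenioid_rlf_isDivSlim`; standard type: seat
  abc-iut-w4-d086's `arith_untr_rlf_isOfStandardType`; hypothesis (b) idle: `arith_rlf_not_isOfGroupLikeType`);
* `arith_rlf_biratCompat` — Cor. 4.10 at the realifications in the input form of the cell's sub-DAG row C54/L03
  (`FrdI.Cor54Sub.BiratCompat`): for the data `(Ψ^Base, E = Ψ^Φ, η)` of Cor. 4.11 at `Ψ^rlf` with its Div formula
  (binders here; supplied hypothesis-free by the sequel), `E_X` carries `(Φ₁^rlf)^birat(X)` ONTO `(Φ₂^rlf)^birat(Ψ^Base X)`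
  — seat abc-iut-w5-d221's generator chase `FrdI.Cor54Sub.biratCompat_of` at the Frobenioids `C_{K_i/F_i}^rlf`, its
  Thm. 3.4 (ii) inputs discharged over the FSM-type bases by seat abc-iut-L1-t13's `FrdI.thm34ii_isotropic_of_isOfFSMType`;
* `arith_rlf_realSpanCompat` — the same read on THE real spans: `E_X(ℝ · Φ₁^birat(X)) = ℝ · Φ₂^birat(Ψ^Base X)`, the
  binder `hspan` of seat abc-iut-w4-d086's `ArithFrd.exists_picMap_thm64ii_functor` (Thm. 6.4 (ii) at THE data).
No definitions; nothing of the paper is restated or strengthened; nothing here bears on [IUTchIII] Cor. 3.12.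
-/

noncomputable section

namespace Literature.AlgebraicGeometry.Frobenioids

open CategoryTheory Opposite Literature.AnabelianGeometry.EtaleTheta
open PreFrobenioid
open PreFrobenioidData (ofFunctor)

universe w v v' u u'

/-! ### Generic: `Φ^rlf` is perf-factorial on `D`; `(Φ^rlf)^birat = ℝ · Φ^birat` for THE realification -/

namespace PreFrobenioid

variable {D : Type u} [Category.{v} D] {Φ : Dᵒᵖ ⥤ CommMonCat.{w}} {C : Type u'} [Category.{v'} C]
  (F : C ⥤ ElemFrobenioid Φ)

/-- `Φ^rlf` is perf-factorial on `D` ("`M^rlf` [is] also perf-factorial", Def. 2.4 (i); seat abc-iut-L1-d2's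
`RealificationIsPerfFactorial_holds` objectwise). [cite: MochizukiFrdI2008, Def. 2.4 (i) p.48] -/
theorem isPerfFactorialOn_rlfFunctor (hΦ : ∀ X : Dᵒᵖ, IsPerfFactorial (Φ.obj X)) :
    IsPerfFactorialOn (rlfFunctor Φ hΦ) :=
  fun X => (hΦ (op X)).RealificationIsPerfFactorial_holds

/-- **`(Φ^rlf)^birat(X) = ℝ · Φ^birat(X)`** for THE realification `C^rlf` of a Frobenioid `C → F_Φ`, `Φ`
perf-factorial: the rational-function subfunctor (Prop. 4.4 (iii), seat abc-iut-L1-t5's `biratSubfunctor`) of the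
model Frobenioid `C^rlf` of `(Φ^rlf, ℝ · Φ^birat)` (Prop. 5.3) is its rational function monoid `ℝ · Φ^birat`
(Thm. 5.2 (ii) "the rational function monoid of `C` is `Φ^birat`", `ModelFrobenioid.biratSubfunctor_eq_ofModelData`).
[cite: MochizukiFrdI2008, Prop. 5.3 p.103] -/
theorem biratSubgroup_rlfToElem_eq_realSpan (hΦ : IsPerfFactorialOn Φ) (X : D) :
    (biratSubfunctor (rlfToElem F hΦ)).carrier X =
      ((RealificationData.canonical Φ (IsPerfFactorialOn.op hΦ)).realSpan (biratSubfunctor F)).carrier X := by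
  have h : biratSubfunctor (rlfToElem F hΦ) =
      GpSubfunctor.ofModelData _ _ _
        ((RealificationData.canonical Φ (IsPerfFactorialOn.op hΦ)).realSpan (biratSubfunctor F)).isUnit_toMonoid :=
    ModelFrobenioid.biratSubfunctor_eq_ofModelData _
  ext c
  rw [h]
  exact ((RealificationData.canonical Φ (IsPerfFactorialOn.op hΦ)).realSpan
    (biratSubfunctor F)).mem_biratSubmonoid_incl_iff (op X) c

end PreFrobenioid

/-! ### Cor. 4.11 / Cor. 4.10 at THE realifications of the arithmetic Frobenioids -/

section Arith

variable (F₁ : Type) [Field F₁] [NumberField F₁] (K₁ : Type) [Field K₁] [Algebra F₁ K₁] [IsGalois F₁ K₁]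
variable (F₂ : Type) [Field F₂] [NumberField F₂] (K₂ : Type) [Field K₂] [Algebra F₂ K₂] [IsGalois F₂ K₂]
variable (hΦ₁ : IsPerfFactorialOn (arithDivisorFunctor F₁ K₁)) (hΦ₂ : IsPerfFactorialOn (arithDivisorFunctor F₂ K₂))

/-- **The hypothesis package of Cor. 4.11 HOLDS at the realifications**, for every equivalence
`Ψ^rlf : C_{K₁/F₁}^rlf ⥲ C_{K₂/F₂}^rlf`: `D_i` Div-slim relative to `Φ_i^rlf` (Thm. 6.4 (i) p. 115 l. 20–21 "`D` is
Div-slim [relative to `Φ`, hence also relative to `Φ^pf`, `Φ^rlf`]"), `C_i^rlf` of standard type (Thm. 6.4 (i) with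
Prop. 5.5 (iii)), hypothesis (b) idle (`C^rlf` is not of group-like type).
[cite: MochizukiFrdI2008, Cor. 4.11 p.91] [cite: MochizukiFrdI2008, Thm. 6.4 (i) p.115] -/
theorem arith_rlf_cor411Setting
    (Ψ : rlf (ModelFrobenioid.toElem (arithDivisorFunctor F₁ K₁) (unitsFunctor F₁ K₁) (divNatTrans F₁ K₁))
          hΦ₁ ≌
        rlf (ModelFrobenioid.toElem (arithDivisorFunctor F₂ K₂) (unitsFunctor F₂ K₂) (divNatTrans F₂ K₂))
          hΦ₂) :
    PreFrobenioidData.Cor411Setting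
      (FrdI.Cor54Sub.rlfData
        (ModelFrobenioid.toElem (arithDivisorFunctor F₁ K₁) (unitsFunctor F₁ K₁) (divNatTrans F₁ K₁))
        hΦ₁)
      (FrdI.Cor54Sub.rlfData
        (ModelFrobenioid.toElem (arithDivisorFunctor F₂ K₂) (unitsFunctor F₂ K₂) (divNatTrans F₂ K₂))
        hΦ₂) Ψ where
  divSlim := ⟨arithFrobenioid_rlf_isDivSlim F₁ K₁ _, arithFrobenioid_rlf_isDivSlim F₂ K₂ _⟩
  standard := ⟨(arith_untr_rlf_isOfStandardType F₁ K₁).2, (arith_untr_rlf_isOfStandardType F₂ K₂).2⟩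
  hypB h₁ _ := absurd h₁ (arith_rlf_not_isOfGroupLikeType F₁ K₁)
/-- **[FrdI] Cor. 4.10 at the realifications** ("Category-theoreticity of the birationalization", p. 90, in the
input form of the cell's sub-DAG row C54/L03 `FrdI.Cor54Sub.BiratCompat`): for the data `(Ψ^Base, E = Ψ^Φ, η)` of
Cor. 4.11 at `Ψ^rlf` with its Div formula, `E_X` carries the rational-function subfunctor `(Φ₁^rlf)^birat(X)` ONTO
`(Φ₂^rlf)^birat(Ψ^Base X)` — seat abc-iut-w5-d221's generator chase `FrdI.Cor54Sub.biratCompat_of` at the Frobenioids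
`C_{K_i/F_i}^rlf`, its Thm. 3.4 (ii) inputs ("`Ψ^rlf`, `(Ψ^rlf)⁻¹` preserve (co-angular) pre-steps") discharged over the
FSM-type bases by seat abc-iut-L1-t13's `FrdI.thm34ii_isotropic_of_isOfFSMType` (`C^rlf` of isotropic type).
[cite: MochizukiFrdI2008, Cor. 4.10 p.90] -/
theorem arith_rlf_biratCompat
    (Ψ : rlf (ModelFrobenioid.toElem (arithDivisorFunctor F₁ K₁) (unitsFunctor F₁ K₁) (divNatTrans F₁ K₁))
          hΦ₁ ≌
        rlf (ModelFrobenioid.toElem (arithDivisorFunctor F₂ K₂) (unitsFunctor F₂ K₂) (divNatTrans F₂ K₂))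
          hΦ₂)
    (ΨBase : FinSubextCat F₁ K₁ ⥤ FinSubextCat F₂ K₂) [ΨBase.Full] [ΨBase.Faithful]
    (E : PreFrobenioidData.DivisorMonoidIsoOverBase
      (FrdI.Cor54Sub.rlfData
        (ModelFrobenioid.toElem (arithDivisorFunctor F₁ K₁) (unitsFunctor F₁ K₁) (divNatTrans F₁ K₁))
        hΦ₁)
      (FrdI.Cor54Sub.rlfData
        (ModelFrobenioid.toElem (arithDivisorFunctor F₂ K₂) (unitsFunctor F₂ K₂) (divNatTrans F₂ K₂))
        hΦ₂) ΨBase)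
    (η : Ψ.functor ⋙
        (FrdI.Cor54Sub.rlfData
          (ModelFrobenioid.toElem (arithDivisorFunctor F₂ K₂) (unitsFunctor F₂ K₂) (divNatTrans F₂ K₂))
          hΦ₂).base ≅
      (FrdI.Cor54Sub.rlfData
          (ModelFrobenioid.toElem (arithDivisorFunctor F₁ K₁) (unitsFunctor F₁ K₁) (divNatTrans F₁ K₁))
          hΦ₁).base ⋙ ΨBase)
    (hdiv : ∀ ⦃A B : rlf (ModelFrobenioid.toElem (arithDivisorFunctor F₁ K₁) (unitsFunctor F₁ K₁)
        (divNatTrans F₁ K₁)) hΦ₁⦄ (φ : A ⟶ B),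
      Div (rlfToElem (ModelFrobenioid.toElem (arithDivisorFunctor F₂ K₂) (unitsFunctor F₂ K₂) (divNatTrans F₂ K₂))
          hΦ₂) (Ψ.functor.map φ) =
        pull _ (η.hom.app A)
          (E.iso (baseObj (rlfToElem (ModelFrobenioid.toElem (arithDivisorFunctor F₁ K₁) (unitsFunctor F₁ K₁)
            (divNatTrans F₁ K₁)) hΦ₁) A)
            (Div (rlfToElem (ModelFrobenioid.toElem (arithDivisorFunctor F₁ K₁) (unitsFunctor F₁ K₁)
              (divNatTrans F₁ K₁)) hΦ₁) φ))) :
    FrdI.Cor54Sub.BiratCompat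
      (rlfToElem (ModelFrobenioid.toElem (arithDivisorFunctor F₁ K₁) (unitsFunctor F₁ K₁) (divNatTrans F₁ K₁))
        hΦ₁)
      (rlfToElem (ModelFrobenioid.toElem (arithDivisorFunctor F₂ K₂) (unitsFunctor F₂ K₂) (divNatTrans F₂ K₂))
        hΦ₂) ΨBase E := by
  have h₁₂ := FrdI.thm34ii_isotropic_of_isOfFSMType (arith_rlf_isFrobenioid F₁ K₁) (arith_rlf_isFrobenioid F₂ K₂)
    (arith_rlf_isOfIsotropicType F₁ K₁) (arith_rlf_isOfIsotropicType F₂ K₂)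
    (FinSubextCat.isOfFSMType F₁ K₁) (FinSubextCat.isOfFSMType F₂ K₂) Ψ
  have h₂₁ := FrdI.thm34ii_isotropic_of_isOfFSMType (arith_rlf_isFrobenioid F₂ K₂) (arith_rlf_isFrobenioid F₁ K₁)
    (arith_rlf_isOfIsotropicType F₂ K₂) (arith_rlf_isOfIsotropicType F₁ K₁)
    (FinSubextCat.isOfFSMType F₂ K₂) (FinSubextCat.isOfFSMType F₁ K₁) Ψ.symm
  exact FrdI.Cor54Sub.biratCompat_of _ _ Ψ (arith_rlf_isFrobenioid F₂ K₂).isPreFrobenioid ΨBase E η hdiv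
    (fun _ _ φ hφ => (PreFrobenioidData.ofFunctor_isPreStep _ _).mpr
      (h₁₂.1 φ ((PreFrobenioidData.ofFunctor_isPreStep _ _).mp hφ)))
    (fun _ _ φ hφ => (PreFrobenioidData.ofFunctor_isCoAngularPreStep _ _).mpr
      (h₁₂.2.1 φ ((PreFrobenioidData.ofFunctor_isCoAngularPreStep _ _).mp hφ)))
    (fun _ _ φ hφ => (PreFrobenioidData.ofFunctor_isPreStep _ _).mpr
      (h₂₁.1 φ ((PreFrobenioidData.ofFunctor_isPreStep _ _).mp hφ)))
    (fun _ _ φ hφ => (PreFrobenioidData.ofFunctor_isCoAngularPreStep _ _).mpr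
      (h₂₁.2.1 φ ((PreFrobenioidData.ofFunctor_isCoAngularPreStep _ _).mp hφ)))
/-- **`E_X(ℝ · Φ₁^birat(X)) = ℝ · Φ₂^birat(Ψ^Base X)`** — Cor. 4.10 at the realifications read on THE real spans of
Prop. 5.3 (seat abc-iut-L1-d2's `RealificationData.realSpan` of the CANONICAL data, `= (Φ^rlf)^birat` by
`PreFrobenioid.biratSubgroup_rlfToElem_eq_realSpan`): the binder `hspan` of seat abc-iut-w4-d086's
`ArithFrd.exists_picMap_thm64ii_functor`, for the Cor. 4.11 data `(Ψ^Base, E, η)` of `Ψ^rlf` with its Div formula.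
[cite: MochizukiFrdI2008, Cor. 4.10 p.90] [cite: MochizukiFrdI2008, Thm. 6.4 (ii) p.115] -/
theorem arith_rlf_realSpanCompat
    (Ψ : rlf (ModelFrobenioid.toElem (arithDivisorFunctor F₁ K₁) (unitsFunctor F₁ K₁) (divNatTrans F₁ K₁))
          hΦ₁ ≌
        rlf (ModelFrobenioid.toElem (arithDivisorFunctor F₂ K₂) (unitsFunctor F₂ K₂) (divNatTrans F₂ K₂))
          hΦ₂)
    (ΨBase : FinSubextCat F₁ K₁ ⥤ FinSubextCat F₂ K₂) [ΨBase.Full] [ΨBase.Faithful]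
    (E : PreFrobenioidData.DivisorMonoidIsoOverBase
      (FrdI.Cor54Sub.rlfData
        (ModelFrobenioid.toElem (arithDivisorFunctor F₁ K₁) (unitsFunctor F₁ K₁) (divNatTrans F₁ K₁))
        hΦ₁)
      (FrdI.Cor54Sub.rlfData
        (ModelFrobenioid.toElem (arithDivisorFunctor F₂ K₂) (unitsFunctor F₂ K₂) (divNatTrans F₂ K₂))
        hΦ₂) ΨBase)
    (η : Ψ.functor ⋙
        (FrdI.Cor54Sub.rlfData
          (ModelFrobenioid.toElem (arithDivisorFunctor F₂ K₂) (unitsFunctor F₂ K₂) (divNatTrans F₂ K₂))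
          hΦ₂).base ≅
      (FrdI.Cor54Sub.rlfData
          (ModelFrobenioid.toElem (arithDivisorFunctor F₁ K₁) (unitsFunctor F₁ K₁) (divNatTrans F₁ K₁))
          hΦ₁).base ⋙ ΨBase)
    (hdiv : ∀ ⦃A B : rlf (ModelFrobenioid.toElem (arithDivisorFunctor F₁ K₁) (unitsFunctor F₁ K₁)
        (divNatTrans F₁ K₁)) hΦ₁⦄ (φ : A ⟶ B),
      Div (rlfToElem (ModelFrobenioid.toElem (arithDivisorFunctor F₂ K₂) (unitsFunctor F₂ K₂) (divNatTrans F₂ K₂))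
          hΦ₂) (Ψ.functor.map φ) =
        pull _ (η.hom.app A)
          (E.iso (baseObj (rlfToElem (ModelFrobenioid.toElem (arithDivisorFunctor F₁ K₁) (unitsFunctor F₁ K₁)
            (divNatTrans F₁ K₁)) hΦ₁) A)
            (Div (rlfToElem (ModelFrobenioid.toElem (arithDivisorFunctor F₁ K₁) (unitsFunctor F₁ K₁)
              (divNatTrans F₁ K₁)) hΦ₁) φ)))
    (X : FinSubextCat F₁ K₁) :
    (((RealificationData.canonical (arithDivisorFunctor F₁ K₁) (IsPerfFactorialOn.op hΦ₁)).realSpan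
        (biratSubfunctor (ModelFrobenioid.toElem (arithDivisorFunctor F₁ K₁) (unitsFunctor F₁ K₁)
          (divNatTrans F₁ K₁)))).carrier X).map (MonGp.map (E.iso X).toMonoidHom) =
      ((RealificationData.canonical (arithDivisorFunctor F₂ K₂) (IsPerfFactorialOn.op hΦ₂)).realSpan
        (biratSubfunctor (ModelFrobenioid.toElem (arithDivisorFunctor F₂ K₂) (unitsFunctor F₂ K₂)
          (divNatTrans F₂ K₂)))).carrier (ΨBase.obj X) := by
  rw [← biratSubgroup_rlfToElem_eq_realSpan, ← biratSubgroup_rlfToElem_eq_realSpan]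
  exact arith_rlf_biratCompat F₁ K₁ F₂ K₂ hΦ₁ hΦ₂ Ψ ΨBase E η hdiv X

end Arith

end Literature.AlgebraicGeometry.Frobenioids

end
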